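import Literature.NumberTheory.Automorphic.Liu2021.Prop413ConstituentsOfDictionary
import Literature.RepresentationTheory.Semisimple.KrullSchmidtIrreducible
import HarnessLib

/-!
# [Liu 2021] proof of Prop. 4.13: occurrence of a constituent in ANY irreducible decomposition, and the arithmetic half of
# Prop. 4.13 from ONE reference decomposition (Krull–Schmidt–Azumaya matching)

Topic `NumberTheory/Automorphic/Liu2021`.  KERNEL ONLY: theorems, no definition, no named fact, no `sorry`; companion of
`Prop413ConstituentsOfDictionary` (same datum `P : Prop413Data F E`, same currencies `OccursInH1` / `IsIsoToOmega` of
`GelbartRogawski1991.OscillatorTripleDictionary`).  Two things are proved, for an arbitrary `𝔾(𝔸_F^∞)`-equivariant decomposition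
`Ψ : H¹_{B,τ'}(A_∞, ℂ) ≃ ⨁_i W_i` into IRREDUCIBLE representations:

* **Occurrence is seen on every decomposition** (`exists_constituent_equiv_of_occursInH1`): an IRREDUCIBLE representation `σ`
  that OCCURS in `H¹_{B,τ'}(A_∞, ℂ)` (a non-zero intertwiner `σ → H¹_{B,τ'}`, [Liu2021, proof of Prop. 4.13, l. 2131] «contributes
  to the Albanese») is `𝔾(𝔸_F^∞)`-equivariantly isomorphic to some constituent `W_i` — some coordinate `σ → W_i` of the intertwiner
  is non-zero, hence bijective by Schur (Mathlib `Representation.IsIrreducible.bijective_or_eq_zero`).  Specialised to the admissible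
  `ω_t` (`occurs_of_admissible`): every admissible weight-one `ω(μ, ε, χ)` that occurs is a constituent of every irreducible
  decomposition.  The occurrence itself enters as a HYPOTHESIS `OccursInH1 P τ' (P.rhoAt t)` from ANY source — the tree's
  `MultOneAsPrinted` (`occursInH1_rhoAt_of_multOne`, used by `Prop413ConstituentsOfDictionary`), or B3-12 (c) (⇐)
  `muAdmissible_iff_multiplicity_one` (`occursInH1_rhoAt_of_muAdmissibleIff` below; [Liu2021, l. 2145] «Conversely, for every
  such adèlic oscillator triple … by the Rallis inner product formula …»), or a later discharge of that clause.
* **The arithmetic half of Prop. 4.13 from a reference decomposition** (`constituents_classified_of_reference`): if ONE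
  equivariant decomposition `Ψ₀ : H¹_{B,τ'}(A_∞, ℂ) ≃ ⨁_t ω_t` over the admissible weight-one triples is given and the `ω_t` are
  irreducible ([Liu2021, Def. 4.11]), then in ANY irreducible decomposition the constituents are, through a bijection of index sets,
  the `ω_t` — by the Krull–Schmidt–Azumaya theorem for direct sums of irreducible representations (tree
  `Representation.exists_equiv_of_equivariant_directSum'`, [Bourbaki, Algèbre VIII § 2 n° 4 Th. 1 Cor. 2]); no multiplicity-one
  input.  In particular (`constituents_classified_of_asPrinted`) Prop. 4.13 AS PRINTED plus Def. 4.11's irreducibility gives the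
  classification back: the cut «irreducible decomposition + classification» of the hodgecm-mathlib line `a3-liu413` loses nothing.
  The conclusions are, CHARACTER FOR CHARACTER, the body of that line's predicate `ConstituentsAreTheta P τ'` (:124–:129).

Nothing of [Liu2021] is asserted; all printed inputs are hypotheses on the consumer's `P`.  NOT here: the dictionary route
(`Prop413ConstituentsOfDictionary`), Prop. 4.13 itself, any statement about a particular `P`.

## References
* [Liu2021] Y. Liu, *Fourier–Jacobi cycles and arithmetic relative trace formula*, Camb. J. Math. **9** (2021) = arXiv:2102.11518 —
  Prop. 4.13 (FJcycle.tex ll. 2113–2119) with its proof ll. 2121–2146 (l. 2131 «contributes», l. 2145 «Conversely … Rallis inner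
  product formula»), Def. 4.11 (ll. 2083–2097).
* [BourbakiAlgebreVIII2012] N. Bourbaki, *Algèbre* VIII, § 2 n° 4 Th. 1 (Azumaya) Cor. 2 (pp. VIII.29–31) — through the tree's
  `Literature/RepresentationTheory/Semisimple/KrullSchmidtIrreducible.lean`.
* Tree: `Liu2021/Prop413ConstituentsOfDictionary.lean` (`exists_intertwiningMap_component`), `GelbartRogawski1991/OscillatorTripleDictionary.lean`
  (`OccursInH1`, `muAdmissible_iff_multiplicity_one`), `Liu2021/Prop413AsPrinted.lean`.
-/

noncomputable section

open NumberField DirectSum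

namespace Literature.NumberTheory.Automorphic.Liu2021

namespace Prop413Data

open Literature.NumberTheory.GelbartRogawski1991 Literature.NumberTheory.GelbartRogawski1991.OscillatorTripleDictionary

variable {F E : Type} [Field F] [NumberField F] [IsTotallyReal F] [Field E] [NumberField E] [Algebra F E]
  [IsTotallyComplex E] [Algebra.IsQuadraticExtension F E] {P : Prop413Data F E}

/-! ## Occurrence is seen on every irreducible decomposition -/

section Decomposition

variable {τ' : E →+* ℂ} {ι : Type} {W : ι → Type} [∀ i, AddCommGroup (W i)] [∀ i, Module ℂ (W i)]
  (ρ : ∀ i, Representation ℂ P.G (W i)) (Ψ : P.HB τ' ≃ₗ[ℂ] (⨁ i, W i))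
  (hΨ : ∀ (g : P.G) (x : P.HB τ') (i : ι), Ψ (P.rhoB τ' g x) i = ρ i g (Ψ x i))

include hΨ

/-- **An irreducible representation occurring in `H¹_{B,τ'}(A_∞, ℂ)` is a constituent of every irreducible decomposition.**  If
`σ` is IRREDUCIBLE and admits a non-zero intertwiner `j : σ → H¹_{B,τ'}(A_∞, ℂ)` ([Liu2021, proof of Prop. 4.13, l. 2131]: «`π`
contributes to the Albanese», read on the finite part `σ = π^∞`), and `Ψ : H¹_{B,τ'} ≃ ⨁_i W_i` is `𝔾(𝔸_F^∞)`-equivariant with the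
`W_i` irreducible, then `σ ≅ W_i` equivariantly for some `i`: pick `v` with `j v ≠ 0` and a coordinate `i` with `(Ψ (j v))_i ≠ 0`;
the coordinate intertwiner `σ → W_i` is non-zero between irreducibles, hence bijective (Schur, Mathlib
`Representation.IsIrreducible.bijective_or_eq_zero`). [cite: Liu2021, proof of Prop. 4.13, l. 2131] -/
theorem exists_constituent_equiv_of_occursInH1 {V : Type} [AddCommGroup V] [Module ℂ V] (σ : Representation ℂ P.G V)
    (hσ : σ.IsIrreducible) (hocc : OccursInH1 P τ' σ) (hirrW : ∀ i, (ρ i).IsIrreducible) :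
    ∃ i : ι, ∃ f : V ≃ₗ[ℂ] W i, ∀ (g : P.G) (v : V), f (σ g v) = ρ i g (f v) := by
  classical
  obtain ⟨j, hj⟩ := hocc
  -- a vector with `j v ≠ 0`, and a coordinate `i` with `(Ψ (j v))_i ≠ 0`
  obtain ⟨v, hv⟩ : ∃ v, j v ≠ 0 := by
    by_contra h
    push Not at h
    exact hj (Representation.IntertwiningMap.ext (LinearMap.ext fun v => by simpa using h v))
  have hΨv : Ψ (j v) ≠ 0 := fun h => hv (by simpa using congrArg Ψ.symm h)
  obtain ⟨i, hi⟩ : ∃ i, Ψ (j v) i ≠ 0 := by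
    by_contra h
    push Not at h
    exact hΨv (DFinsupp.ext h)
  obtain ⟨q, hq⟩ := exists_intertwiningMap_component ρ Ψ hΨ i
  -- `q ∘ j : σ → W_i` is a non-zero intertwiner between irreducibles, hence bijective
  let Q : Representation.IntertwiningMap σ (ρ i) := q.comp j
  have hQ : ∀ u, Q u = Ψ (j u) i := fun u => by
    show q (j u) = _
    exact hq (j u)
  have hQ0 : Q ≠ 0 := by
    intro h0
    apply hi
    rw [← hQ, h0]
    rfl
  haveI := hσ
  haveI := hirrW i
  have hbij : Function.Bijective Q := (Representation.IsIrreducible.bijective_or_eq_zero Q).resolve_right hQ0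
  let eQ : V ≃ₗ[ℂ] W i := LinearEquiv.ofBijective Q.toLinearMap hbij
  have heQ : ∀ u, eQ u = Q u := fun u => rfl
  refine ⟨i, eQ, fun g u => ?_⟩
  rw [heQ, heQ]
  exact Representation.IntertwiningMap.isIntertwining σ (ρ i) Q g u

/-- **Every admissible weight-one `ω(μ, ε, χ)` that occurs in `H¹_{B,τ'}(A_∞, ℂ)` is a constituent of every irreducible decomposition**
(the OCCURRENCE clause of [Liu2021, proof of Prop. 4.13, l. 2145] «Conversely, for every such adèlic oscillator triple `(μ,ε,χ)` …
`ω(μ,ε,χ)` is isomorphic to `π^∞` and `H¹(𝔤, K_G; π_∞) ≠ {0}` … by the Rallis inner product formula …», read on an ARBITRARY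
decomposition): given `OccursInH1 P τ' (P.rhoAt t)` (from any source) and the irreducibility of `ω_t` ([Liu2021, Def. 4.11]), some
constituent `W_i` is `≅ ω_t` equivariantly. [cite: Liu2021, proof of Prop. 4.13, l. 2145; Def. 4.11] -/
theorem occurs_of_admissible (hirrW : ∀ i, (ρ i).IsIrreducible) (t : P.AdmTriple)
    (hocc : OccursInH1 P τ' (P.rhoAt t)) (hirr : (P.rhoAt t).IsIrreducible) :
    ∃ i : ι, ∃ f : W i ≃ₗ[ℂ] P.omegaAt t, ∀ (g : P.G) (w : W i), f (ρ i g w) = P.rhoAt t g (f w) := by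
  obtain ⟨i, f, hf⟩ := exists_constituent_equiv_of_occursInH1 ρ Ψ hΨ (P.rhoAt t) hirr hocc hirrW
  refine ⟨i, f.symm, fun g w => ?_⟩
  rw [LinearEquiv.symm_apply_eq, hf, LinearEquiv.apply_symm_apply]

/-- The same in the currency `IsIsoToOmega` of the oscillator-triple dictionary. [cite: Liu2021, proof of Prop. 4.13, l. 2145] -/
theorem exists_constituent_isIsoToOmega_of_occursInH1 (hirrW : ∀ i, (ρ i).IsIrreducible) (t : P.AdmTriple)
    (hocc : OccursInH1 P τ' (P.rhoAt t)) (hirr : (P.rhoAt t).IsIrreducible) : ∃ i : ι, IsIsoToOmega P (ρ i) t.1 :=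
  occurs_of_admissible ρ Ψ hΨ hirrW t hocc hirr

end Decomposition

/-- **Occurrence from B3-12 (c) (⇐)** — [Liu2021, proof of Prop. 4.13, l. 2145] «Conversely, for every such adèlic oscillator triple
… `Θ^V_{(μ,ν),W}(π_W)` is contained in `L²_disc(G)`» (at `n = 3`, per [Liu2021, Rem. 4.14], the multiplicity rule of [GR91] p. 446):
under `muAdmissible_iff_multiplicity_one P` every admissible weight-one `ω_t` OCCURS in `H¹_{B,τ'}(A_∞, ℂ)` — an occurrence source
INDEPENDENT of the multiplicity value `MultOneAsPrinted`. [cite: Liu2021, proof of Prop. 4.13, l. 2145; Rem. 4.14]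
[cite: GelbartRogawski1991, Introduction p. 446 L9–11] -/
theorem occursInH1_rhoAt_of_muAdmissibleIff (h : muAdmissible_iff_multiplicity_one P) (hn : P.n = 3) (τ' : E →+* ℂ)
    (t : P.AdmTriple) : OccursInH1 P τ' (P.rhoAt t) :=
  (h hn τ' t.1 t.2.1).2 t.2.2

/-! ## The arithmetic half of Prop. 4.13 from ONE reference decomposition (Krull–Schmidt–Azumaya) -/

/-- **[Liu2021, Prop. 4.13, arithmetic half] from a reference decomposition.**  If `Ψ₀ : H¹_{B,τ'}(A_∞, ℂ) ≃ ⨁_t ω_t` is ONE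
`𝔾(𝔸_F^∞)`-equivariant decomposition over the admissible weight-one triples (the printed isomorphism of Prop. 4.13 at `τ'`) and every
`ω_t` is irreducible ([Liu2021, Def. 4.11] «an irreducible admissible representation»), then in ANY equivariant decomposition
`Ψ : H¹_{B,τ'} ≃ ⨁_i W_i` into irreducibles there is a bijection `e : {admissible weight-one triples} ≃ ι` with `W_{e t} ≅ ω_t`
equivariantly — the Krull–Schmidt–Azumaya theorem for direct sums of irreducible representations [Bourbaki, Algèbre VIII § 2 n° 4
Th. 1 Cor. 2] (tree `Representation.exists_equiv_of_equivariant_directSum'`); NO multiplicity-one input, arbitrary multiplicities.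
The conclusion is VERBATIM the body of `ConstituentsAreTheta P τ'` of the hodgecm-mathlib crux skeleton `Lines/a3-liu413.lean`.
[cite: Liu2021, Prop. 4.13; Def. 4.11] [cite: BourbakiAlgebreVIII2012, VIII §2 n°4 Th. 1 Cor. 2] -/
theorem constituents_classified_of_reference (τ' : E →+* ℂ) (Ψ₀ : P.HB τ' ≃ₗ[ℂ] (⨁ t : P.AdmTriple, P.omegaAt t))
    (hΨ₀ : ∀ (g : P.G) (x : P.HB τ') (t : P.AdmTriple), Ψ₀ (P.rhoB τ' g x) t = P.rhoAt t g (Ψ₀ x t))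
    (hirr : ∀ t : P.AdmTriple, (P.rhoAt t).IsIrreducible) :
    ∀ (ι : Type) (W : ι → Type) [∀ i, AddCommGroup (W i)] [∀ i, Module ℂ (W i)] (ρ : ∀ i, Representation ℂ P.G (W i)),
      (∀ i, (ρ i).IsIrreducible) →
      ∀ Ψ : P.HB τ' ≃ₗ[ℂ] (⨁ i, W i), (∀ (g : P.G) (x : P.HB τ') (i : ι), Ψ (P.rhoB τ' g x) i = ρ i g (Ψ x i)) →
        ∃ e : P.AdmTriple ≃ ι, ∀ t : P.AdmTriple, ∃ f : W (e t) ≃ₗ[ℂ] P.omegaAt t,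
          ∀ (g : P.G) (w : W (e t)), f (ρ (e t) g w) = P.rhoAt t g (f w) :=
  fun _ _ _ _ ρ hρ Ψ hΨ =>
    Representation.exists_equiv_of_equivariant_directSum' (P.rhoB τ') (fun t => P.rhoAt t) hirr Ψ₀ hΨ₀ ρ hρ Ψ hΨ

/-- **The cut of Prop. 4.13 into «irreducible decomposition» + «classification of the constituents» is lossless**: Prop. 4.13 AS
PRINTED (`Prop413AsPrinted P`, the existence of the equivariant isomorphism `H¹_{B,τ'}(A_∞, ℂ) ≃ ⊕_t ω_t` for `n ≥ 3` and every `τ'`)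
together with [Liu2021, Def. 4.11]'s irreducibility of the admissible `ω_t` gives back the classification of the constituents of ANY
irreducible decomposition (`constituents_classified_of_reference` at the printed isomorphism).  The conclusion is the shape
`3 ≤ P.n → ∀ τ', ConstituentsAreTheta P τ'` of `Lines/a3-liu413.lean`. [cite: Liu2021, Prop. 4.13; Def. 4.11]
[cite: BourbakiAlgebreVIII2012, VIII §2 n°4 Th. 1 Cor. 2] -/
theorem constituents_classified_of_asPrinted (h : Liu2021.Prop413AsPrinted P)
    (hirr : ∀ t : P.AdmTriple, (P.rhoAt t).IsIrreducible) :
    3 ≤ P.n → ∀ (τ' : E →+* ℂ) (ι : Type) (W : ι → Type) [∀ i, AddCommGroup (W i)] [∀ i, Module ℂ (W i)]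
      (ρ : ∀ i, Representation ℂ P.G (W i)), (∀ i, (ρ i).IsIrreducible) →
      ∀ Ψ : P.HB τ' ≃ₗ[ℂ] (⨁ i, W i), (∀ (g : P.G) (x : P.HB τ') (i : ι), Ψ (P.rhoB τ' g x) i = ρ i g (Ψ x i)) →
        ∃ e : P.AdmTriple ≃ ι, ∀ t : P.AdmTriple, ∃ f : W (e t) ≃ₗ[ℂ] P.omegaAt t,
          ∀ (g : P.G) (w : W (e t)), f (ρ (e t) g w) = P.rhoAt t g (f w) := by
  intro hn τ'
  obtain ⟨Ψ₀, hΨ₀⟩ := h hn τ'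
  exact constituents_classified_of_reference τ' Ψ₀ hΨ₀ hirr

/-- **Irreducible-or-zero variant** ([Liu2021, Def. 4.11] READING I1 `IsIrreducibleOrZero`, the hypothesis shape of
`Prop413ConstituentsOfDictionary`): if the admissible `ω_t` are irreducible-or-zero and each OCCURS in `H¹_{B,τ'}(A_∞, ℂ)` (so none is
zero), the reference route applies. [cite: Liu2021, Prop. 4.13; Def. 4.11] -/
theorem isIrreducible_rhoAt_of_occursInH1 {τ' : E →+* ℂ} (t : P.AdmTriple) (hirr : IsIrreducibleOrZero (P.rhoAt t))
    (hocc : OccursInH1 P τ' (P.rhoAt t)) : (P.rhoAt t).IsIrreducible := by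
  obtain ⟨j, hj⟩ := hocc
  haveI : Nontrivial (P.omegaAt t) := by
    by_contra hnt
    haveI : Subsingleton (P.omegaAt t) := not_nontrivial_iff_subsingleton.mp hnt
    apply hj
    apply Representation.IntertwiningMap.ext
    ext v
    rw [Subsingleton.elim v 0]
    simp
  exact isIrreducible_of_nontrivial hirr

/-! ## Multiplicity one = (multiplicity at most one) + (occurrence): the dictionary route with the two halves separated -/

/-- **`dim = 1` is `dim ≤ 1` plus occurrence.**  The printed multiplicity-one sentence `MultOneAsPrinted P` ([Liu2021, proof of
Prop. 4.13, l. 2145] «the dimension of `H¹_{B,τ'}(A_∞, ℂ)[ω(μ,ε,χ)]` is `1`») splits into its two printed sources: «`≤ 1`» —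
multiplicity one of the automorphic spectrum ([Rogawski1990, Thm. 13.3.1] at `n = 3`; `m_disc(π) = 1` and `dim H¹(𝔤,K;π_∞)_{τ'} = 1`,
l. 2131–2145) — and «`≥ 1`» — OCCURRENCE of every admissible `ω_t` (l. 2145 «Conversely … by the Rallis inner product formula»; the
cell's node B3-13).  Kernel: a `ℂ`-space of rank `≤ 1` with a non-zero element has rank `1`.
[cite: Liu2021, proof of Prop. 4.13, l. 2145] [cite: Rogawski1990, Thm. 13.3.1] -/
theorem multOneAsPrinted_of_rank_le_one_of_occursInH1
    (hle : 3 ≤ P.n → ∀ (τ' : E →+* ℂ) (t : P.AdmTriple),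
      Module.rank ℂ (Representation.IntertwiningMap (P.rhoAt t) (P.rhoB τ')) ≤ 1)
    (hocc : 3 ≤ P.n → ∀ (τ' : E →+* ℂ) (t : P.AdmTriple), OccursInH1 P τ' (P.rhoAt t)) : P.MultOneAsPrinted := by
  intro hn τ' t
  refine le_antisymm (hle hn τ' t) ?_
  obtain ⟨j, hj⟩ := hocc hn τ' t
  haveI : Nontrivial (Representation.IntertwiningMap (P.rhoAt t) (P.rhoB τ')) := ⟨⟨j, 0, hj⟩⟩
  exact Cardinal.one_le_iff_pos.mpr ((rank_pos_iff_nontrivial (R := ℂ)).mpr inferInstance)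

/-- **The arithmetic half of [Liu2021, Prop. 4.13] at `n = 3` from FOUR separately sourced inputs**: the oscillator-triple
dictionary `hdict` (B3-12 (a): [GR91] p. 448 + Thm 5.1.1 in Liu's labels, [Liu2021, Rem. 4.14]), multiplicity AT MOST one `hle`
([Rogawski1990, Thm. 13.3.1]; B3-08), OCCURRENCE of every admissible `ω_t` `hocc` (B3-13: Rallis inner product formula, l. 2145;
from ANY source) and [Liu2021, Def. 4.11]'s irreducible-or-zero `hirr` — the tree's `constituents_classified_of_dictionary_of_multOne`
(`Prop413ConstituentsOfDictionary`) with its input `MultOneAsPrinted` assembled from `hle` + `hocc`.  Conclusion VERBATIM the body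
of `ConstituentsAreTheta P τ'` of `Lines/a3-liu413.lean`. [cite: Liu2021, Prop. 4.13 with proof l. 2131–2146; Rem. 4.14; Def. 4.11]
[cite: GelbartRogawski1991, Introduction p. 448 L30–33; Thm 5.1.1 p. 465] [cite: Rogawski1990, Thm. 13.3.1] -/
theorem constituents_classified_of_dictionary_of_rank_le_one_of_occursInH1 (hdict : oscillatorTriple_dictionary P)
    (hle : 3 ≤ P.n → ∀ (τ' : E →+* ℂ) (t : P.AdmTriple),
      Module.rank ℂ (Representation.IntertwiningMap (P.rhoAt t) (P.rhoB τ')) ≤ 1)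
    (hocc : 3 ≤ P.n → ∀ (τ' : E →+* ℂ) (t : P.AdmTriple), OccursInH1 P τ' (P.rhoAt t))
    (hirr : ∀ t : P.AdmTriple, IsIrreducibleOrZero (P.rhoAt t)) (hn : P.n = 3) (τ' : E →+* ℂ) :
    ∀ (ι : Type) (W : ι → Type) [∀ i, AddCommGroup (W i)] [∀ i, Module ℂ (W i)] (ρ : ∀ i, Representation ℂ P.G (W i)),
      (∀ i, (ρ i).IsIrreducible) →
      ∀ Ψ : P.HB τ' ≃ₗ[ℂ] (⨁ i, W i), (∀ (g : P.G) (x : P.HB τ') (i : ι), Ψ (P.rhoB τ' g x) i = ρ i g (Ψ x i)) →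
        ∃ e : P.AdmTriple ≃ ι, ∀ t : P.AdmTriple, ∃ f : W (e t) ≃ₗ[ℂ] P.omegaAt t,
          ∀ (g : P.G) (w : W (e t)), f (ρ (e t) g w) = P.rhoAt t g (f w) :=
  constituents_classified_of_dictionary_of_multOne hdict (multOneAsPrinted_of_rank_le_one_of_occursInH1 hle hocc) hirr hn τ'

/-- **The same with OCCURRENCE taken from B3-12 (c) (⇐)** `muAdmissible_iff_multiplicity_one P` («`ε` `μ`-admissible ⟹ `ω(μ,ε,χ)`
occurs», [Liu2021, l. 2145] «Conversely …»; at `n = 3` the multiplicity rule [GR91, p. 446 L9–11]) — so that the inputs at the pin are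
the dictionary (a), its clause (c) (⇐), multiplicity AT MOST one, and Def. 4.11, each with its own printed source.
[cite: Liu2021, Prop. 4.13 with proof l. 2131–2146; Rem. 4.14; Def. 4.11] [cite: GelbartRogawski1991, Introduction p. 446 L9–11, p. 448 L30–33; Thm 5.1.1 p. 465]
[cite: Rogawski1990, Thm. 13.3.1] -/
theorem constituents_classified_of_dictionary_of_rank_le_one_of_muAdmissibleIff (hdict : oscillatorTriple_dictionary P)
    (hadm : muAdmissible_iff_multiplicity_one P)
    (hle : 3 ≤ P.n → ∀ (τ' : E →+* ℂ) (t : P.AdmTriple),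
      Module.rank ℂ (Representation.IntertwiningMap (P.rhoAt t) (P.rhoB τ')) ≤ 1)
    (hirr : ∀ t : P.AdmTriple, IsIrreducibleOrZero (P.rhoAt t)) (hn : P.n = 3) (τ' : E →+* ℂ) :
    ∀ (ι : Type) (W : ι → Type) [∀ i, AddCommGroup (W i)] [∀ i, Module ℂ (W i)] (ρ : ∀ i, Representation ℂ P.G (W i)),
      (∀ i, (ρ i).IsIrreducible) →
      ∀ Ψ : P.HB τ' ≃ₗ[ℂ] (⨁ i, W i), (∀ (g : P.G) (x : P.HB τ') (i : ι), Ψ (P.rhoB τ' g x) i = ρ i g (Ψ x i)) →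
        ∃ e : P.AdmTriple ≃ ι, ∀ t : P.AdmTriple, ∃ f : W (e t) ≃ₗ[ℂ] P.omegaAt t,
          ∀ (g : P.G) (w : W (e t)), f (ρ (e t) g w) = P.rhoAt t g (f w) :=
  constituents_classified_of_dictionary_of_rank_le_one_of_occursInH1 hdict hle
    (fun _ τ' t => occursInH1_rhoAt_of_muAdmissibleIff hadm hn τ' t) hirr hn τ'

end Prop413Data

end Literature.NumberTheory.Automorphic.Liu2021

end
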